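import Summits.ValiantsHypothesis.ValiantsHypothesis.Theorems.BarrierLeverFormulaSliceEquations

/-!
# Route BarrierLever — the MODEL axis of item `SingleSizeEquations` (stmt-ValiantsHypothesis-8749),
# part 3: Kalorkoti's explicit polynomial and the quadratic formula lower bound it certifies

Parts 1–2 (`…FormulaSliceRank.lean`, `…FormulaSliceEquations.lean`) give the level-12 distinguisher
`formulaCert n` vanishing on every `n`-variate polynomial with a fan-in-two formula of at most
`S` gates whenever `4 (S + 1) < ⌈n/2⌉ ⌊n/2⌋`.  Here the NON-ROOT is made explicit INSIDE the
degree-`≤ n` slice: Kalorkoti's polynomial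
`hardPoly n = Σ_{k < ⌈n/2⌉} Σ_{j < ⌊n/2⌋} x_{⌊n/2⌋+k}^{j+1} · x_j` (degree `⌊n/2⌋ + 1 ≤ n`,
`hardPoly_eq_sum`, `totalDegree_hardPoly_le`) has coefficient vector equal to the diagonal
indicator of part 2 (`coeffVector_hardPoly`), so `formulaCert n` evaluates to `1` at it
(`eval_coeffVector_hardPoly_formulaCert`) and the certificate form of Kalorkoti's theorem gives
the explicit quadratic lower bound `⌈n/2⌉ ⌊n/2⌋ ≤ 4 (E(hardPoly n) + 1)`
(`formulaComplexity_hardPoly_lower_bound`; `E` = `formulaComplexity`, gates of a fan-in-two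
formula), i.e. `E(hardPoly n) > n²/20` for `n ≥ 10` (`hardPoly_not_mem_formulaSlice`): the
natural proof of part 2 is USEFUL against the formula slice and its largeness is witnessed in the
slice itself.  WHAT THIS IS NOT: a new lower bound (Kalorkoti 1985 proves `Ω(n²)`-type formula
bounds for such polynomials); nothing on circuits, 8745/8749 proper, or VP vs VNP.
References: Kalorkoti 1985, Thm. 1; Forbes–Shpilka–Volk 2018, Def. 1.
-/

-- layout Summits/ValiantsHypothesis/ValiantsHypothesis forces the duplicated namespace component
set_option linter.dupNamespace false

noncomputable section

open MvPolynomial Finsupp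

namespace Summit.ValiantsHypothesis.ValiantsHypothesis.Theorems.BarrierLever.FormulaSlice

open Literature.Computability.AlgebraicComplexity Literature.Barriers.ValiantsHypothesis

section witness

variable (n : ℕ)

/-- **Kalorkoti's explicit polynomial** `Σ_{k < ⌈n/2⌉} Σ_{j < ⌊n/2⌋} x_{⌊n/2⌋+k}^{j+1} x_j`, written
as the sum of the "diagonal" monomials `certMonomial n k j j` (see `hardPoly_eq_sum`).
[cite: Kalorkoti1985, Thm. 1] -/
def hardPoly : MvPolynomial (Fin n) ℂ :=
  ∑ k : Fin (n - n / 2), ∑ j : Fin (n / 2),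
    monomial ((certMonomial n k j j : degLEMonomials n) : Fin n →₀ ℕ) 1

/-- `hardPoly n = Σ_k Σ_j x_{⌊n/2⌋+k}^{j+1} · x_j`. [cite: Kalorkoti1985, Thm. 1] -/
theorem hardPoly_eq_sum : hardPoly n = ∑ k : Fin (n - n / 2), ∑ j : Fin (n / 2),
    X (blockVar n k) ^ ((j : ℕ) + 1) * X (colVar n j) := by
  refine Finset.sum_congr rfl fun k _ => Finset.sum_congr rfl fun j _ => ?_
  rw [certMonomial, monomial_single_add]
  rfl

/-- `deg (hardPoly n) ≤ n` (every monomial has degree `j + 2 ≤ ⌊n/2⌋ + 1 ≤ n`). [folklore] -/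
theorem totalDegree_hardPoly_le : (hardPoly n).totalDegree ≤ n := by
  classical
  refine (totalDegree_finsetSum _ _).trans (Finset.sup_le fun k _ => ?_)
  refine (totalDegree_finsetSum _ _).trans (Finset.sup_le fun j _ => ?_)
  refine (totalDegree_monomial_le _ _).trans ?_
  have h : Finsupp.degree ((certMonomial n k j j : degLEMonomials n) : Fin n →₀ ℕ) ≤ n :=
    (certMonomial n k j j).2
  simpa [Finsupp.sum, Finsupp.degree_apply] using h

variable {n}

/-- The coefficients of `hardPoly n` on the coordinates `c_{y^{j+1} x_l}`: the identity pattern.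
[folklore] -/
theorem coeff_hardPoly_certMonomial (k : Fin (n - n / 2)) (j l : Fin (n / 2)) :
    coeff ((certMonomial n k j l : degLEMonomials n) : Fin n →₀ ℕ) (hardPoly n) =
      if j = l then 1 else 0 := by
  classical
  simp only [hardPoly, coeff_sum, coeff_monomial, Subtype.coe_inj, certMonomial_eq_iff]
  by_cases hjl : j = l
  · subst hjl
    rw [if_pos rfl, Finset.sum_eq_single k, Finset.sum_eq_single j]
    · rw [if_pos ⟨rfl, rfl, rfl⟩]
    · intro j' _ hj'
      exact if_neg fun h => hj' h.2.1
    · simp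
    · intro k' _ hk'
      exact Finset.sum_eq_zero fun j' _ => if_neg fun h => hk' h.1
    · simp
  · rw [if_neg hjl]
    exact Finset.sum_eq_zero fun k' _ => Finset.sum_eq_zero fun j' _ =>
      if_neg fun h => hjl (h.2.1.symm.trans h.2.2)

/-- Any coordinate that is not a diagonal coordinate carries coefficient `0` in `hardPoly n`.
[folklore] -/
theorem coeff_hardPoly_eq_zero {m : Fin n →₀ ℕ}
    (hm : ¬ ∃ (k : Fin (n - n / 2)) (j : Fin (n / 2)),
      m = ((certMonomial n k j j : degLEMonomials n) : Fin n →₀ ℕ)) :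
    coeff m (hardPoly n) = 0 := by
  classical
  simp only [hardPoly, coeff_sum, coeff_monomial]
  exact Finset.sum_eq_zero fun k _ => Finset.sum_eq_zero fun j _ =>
    if_neg fun h => hm ⟨k, j, h.symm⟩

/-- **The coefficient vector of `hardPoly n` is the diagonal indicator** of part 2. [folklore] -/
theorem coeffVector_hardPoly : coeffVector (degLEMonomials n) (hardPoly n) = diagIndicator n := by
  classical
  funext m
  rw [coeffVector_apply]
  unfold diagIndicator
  split_ifs with h
  · obtain ⟨k, j, rfl⟩ := h
    rw [coeff_hardPoly_certMonomial, if_pos rfl]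
  · exact coeff_hardPoly_eq_zero fun ⟨k, j, hkj⟩ => h ⟨k, j, Subtype.ext hkj⟩

/-- `formulaCert n` evaluates to `1` at `coeff(hardPoly n)`: an explicit non-root in the
degree-`≤ n` slice. [cite: Kalorkoti1985, Thm. 1] -/
theorem eval_coeffVector_hardPoly_formulaCert :
    eval (coeffVector (degLEMonomials n) (hardPoly n)) (formulaCert n) = 1 := by
  rw [coeffVector_hardPoly, eval_diagIndicator_formulaCert]

/-- **Kalorkoti's quadratic formula lower bound, explicit form**:
`⌈n/2⌉ · ⌊n/2⌋ ≤ 4 (E(hardPoly n) + 1)`, i.e. every fan-in-two formula for the `n`-variate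
degree-`(⌊n/2⌋+1)` polynomial `Σ_k Σ_j x_{⌊n/2⌋+k}^{j+1} x_j` has more than `n²/16 - 2` gates.
[cite: Kalorkoti1985, Thm. 1] -/
theorem formulaComplexity_hardPoly_lower_bound :
    (n - n / 2) * (n / 2) ≤ 4 * (formulaComplexity (hardPoly n) + 1) :=
  le_formulaComplexity_of_eval_ne_zero _ (by
    rw [eval_coeffVector_hardPoly_formulaCert]; exact one_ne_zero)

/-- **Largeness inside the slice**: for `n ≥ 10`, `hardPoly n` has degree `≤ n` but formula
complexity `> n²/20`, and the level-12 distinguisher `formulaCert n` of part 2 does not vanish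
at it. [cite: Kalorkoti1985, Thm. 1] -/
theorem hardPoly_not_mem_formulaSlice (hn : 10 ≤ n) :
    (hardPoly n).totalDegree ≤ n ∧ ¬ formulaComplexity (hardPoly n) ≤ n * n / 20 ∧
      eval (coeffVector (degLEMonomials n) (hardPoly n)) (formulaCert n) ≠ 0 := by
  refine ⟨totalDegree_hardPoly_le n, fun h => ?_, by
    rw [eval_coeffVector_hardPoly_formulaCert]; exact one_ne_zero⟩
  have h1 := formulaComplexity_hardPoly_lower_bound (n := n)
  have h2 := four_mul_sq_div_twenty_succ_lt hn
  omega

/-- **The natural proof of part 2 with its explicit witness** (FSV Def. 1 + usefulness): for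
`n ≥ 10`, `formulaCert n ∈ Distinguishers ℂ n 12` vanishes on the slice
`{f : deg f ≤ n, E(f) ≤ n²/20}` and is nonzero at the member `hardPoly n` of the degree-`≤ n`
slice. [cite: ForbesShpilkaVolk2018, Def. 1] -/
theorem isNaturalProof_formulaCert_hardPoly (hn : 10 ≤ n) :
    IsNaturalProof (degLEMonomials n)
        {f : MvPolynomial (Fin n) ℂ | f.totalDegree ≤ n ∧ formulaComplexity f ≤ n * n / 20}
        (Distinguishers ℂ n 12) (formulaCert n) ∧
      (hardPoly n).totalDegree ≤ n ∧
      eval (coeffVector (degLEMonomials n) (hardPoly n)) (formulaCert n) ≠ 0 :=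
  ⟨isNaturalProof_formulaCert (four_mul_sq_div_twenty_succ_lt hn), totalDegree_hardPoly_le n,
    (hardPoly_not_mem_formulaSlice hn).2.2⟩

end witness

end Summit.ValiantsHypothesis.ValiantsHypothesis.Theorems.BarrierLever.FormulaSlice

end
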